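import Mathlib.Data.Real.Basic
import Mathlib.Algebra.BigOperators.Field
import Mathlib.Algebra.Order.BigOperators.Group.Finset
import Mathlib.Tactic.FieldSimp
import Mathlib.Tactic.Ring
import HarnessLib

/-!
# R90-TF · S4 «Ch. 13.1–2», letter (WEYL-COUNT) made FINER — ONE finite fact per Cartan type yields BOTH Weyl counts: the S-side clause (C) of ★ `IsStableTransportDict` and the
# T-side (WEYL-COUNT-T) of the twisted Weyl formula (Rogawski 1990, §12.5 p. 182: «the number of `ν ∈ 𝔇(T∕F)` such that `T^ν` is conjugate to `T″` is `|Ω_F(T)|∕|Ω(T″)|`»)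

Cell `hodgecm-mathlib`, crux H413 (`stmt-HodgeConjecture-24833`, lane `--supports … --as helper`), route of record `HCCMUnconditional` (no route verbs;
count-neutral).  Programme R90-TF, section S4, dealer K2E2-plan (g7): RULING S4-R27 (2′)(a) 2026-09-05T01:16:33Z «p12 types the GENERIC ALGEBRA file `Theorems/R90S4WeylCountFiner.lean`:
predicate `FinerCount` + «FinerCount ⇒ (C)» + «FinerCount ⇒ (WEYL-COUNT-T)»»; seat K2E3-p12 (g10).  GENERIC FINITE ALGEBRA — no S4 token: an index type `ι` (the Cartan system `↥C`),
class counts `μ` (`= |𝔇(T∕F)|`: 1, 4, 2, 1), FIBRE COUNTS `N i k` (= the number of transports from `T_i` landing in `T_k` = the VISIBLE data of ★ `isStableTransportDict_of_forall_member`,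
★ p864030), Weyl indices `w i = [N(T_i):T_i]` and `wF i` (`= |Ω_F(T_i)|`, or directly the ε-Weyl count `|W̃^ε_{T_i}|` of ★ `R90S4EpsWeylFinite` — the algebra never needs their
identification).  THE FINER FACT (`IsFinerCount`, §1): on «reachable» pairs (`N i k ≠ 0`, i.e. `T_i ∼_{st} T_k`) the fibre has `N i k · w k = wF k` elements (p. 182's count), `μ` and
`wF` are stable-class invariants, reachability is symmetric and reflexive, `w > 0`, and the fibres of `T_i` exhaust `μ i`.  CONSEQUENCES (§2): the CLASS EQUATION
`Σ_{k ∼ i} [N(T_k):T_k]⁻¹ = |𝔇|∕|Ω_F|` (S4-R27 (1)), the S-COUNT (C) `Σ_i N i k · ([N(T_i):T_i] · μ i)⁻¹ = [N(T_k):T_k]⁻¹` (the `hC` of ★ `isStableTransportDict_of_forall_member`,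
VERBATIM), and the T-COUNT `wF k · Σ_{i ∼ k} ([N(T_i):T_i] · μ i)⁻¹ = 1` ((WEYL-COUNT-T) of the T-WIF HEADS sheet, keyed on `N k i ≠ 0` ⟺ `∃ j, τ k j = i` ⟺ the ε-tubes over
`T_k, T_i` coincide, ★ `R90S4EpsTubeEq`).  Type (1) check (`w = 6, 2`, `wF = 6`, `μ = 4`, `N(·,T₁) = 1`, `N(·,T₂) = 3`): class equation `1∕6 + 1∕2 = 4∕6`; (C) `1∕24 + 1∕8 = 1∕6`,
`3∕24 + 3∕8 = 1∕2`; (T) `6 · (1∕24 + 1∕8) = 1`.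

HONEST LABEL: HC_CM is proved only modulo the 7 printed citations (2 remaining named inputs: hLiu418 = stmt-HodgeConjecture-24832, h413 = stmt-HodgeConjecture-24833) until rung 0
closes.  Pure finite algebra; the FINER FACT is paid per Cartan type by the (DICT) hands; count letters are inputs of (B2-S)∕(B1) behind the OPEN (W-NP).  REL ≠ ★ ≠ BUILT.
One definition (review lane, D-0009), theorems otherwise; no instance, no notation, no `sorry`.

## References
* [Rogawski1990] J. D. Rogawski, *Automorphic Representations of Unitary Groups in Three Variables*, Ann. of Math. Stud. 123 (1990), §12.5 pp. 182, 186; §3.6 pp. 28–31.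
-/

set_option autoImplicit false
set_option linter.dupNamespace false

namespace Summit.HodgeConjecture.HodgeConjecture.R90.S4

section WeylCountFiner

variable {ι : Type} [Fintype ι]

/-! ## §1 The finer count -/

/-- **THE FINER WEYL COUNT** on class counts `μ`, fibre counts `N`, Weyl indices `w` and `wF` (Rogawski p. 182: «the number of `ν ∈ 𝔇(T∕F)` such that `T^ν` is conjugate to `T″` is
`|Ω_F(T)|∕|Ω(T″)|`»): (F1) on reachable pairs the fibre count times `[N(T_k):T_k]` is `wF k`; (F2) `μ` and `wF` are constant along reachability; (F3) reachability is symmetric and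
(F4) reflexive; (F5) `w > 0`; (F6) the fibres of `T_i` exhaust `μ i`. [cite: Rogawski1990, §12.5 p. 182; §3.6 pp. 28–31] -/
def IsFinerCount (μ : ι → ℕ) (N : ι → ι → ℕ) (w wF : ι → ℕ) : Prop :=
  (∀ i k, N i k ≠ 0 → N i k * w k = wF k) ∧ (∀ i k, N i k ≠ 0 → μ i = μ k ∧ wF i = wF k) ∧ (∀ i k, N i k ≠ 0 → N k i ≠ 0) ∧
    (∀ i, N i i ≠ 0) ∧ (∀ i, 0 < w i) ∧ (∀ i, ∑ k, N i k = μ i)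

variable {μ : ι → ℕ} {N : ι → ι → ℕ} {w wF : ι → ℕ}

/-- (F5) `[N(T):T] > 0`. [cite: Rogawski1990, §12.5 p. 182] -/
theorem IsFinerCount.w_pos (h : IsFinerCount μ N w wF) (i : ι) : 0 < w i := h.2.2.2.2.1 i

/-- `wF k = N k k · w k > 0`. [cite: Rogawski1990, §12.5 p. 182] -/
theorem IsFinerCount.wF_pos (h : IsFinerCount μ N w wF) (k : ι) : 0 < wF k := by
  rw [← h.1 k k (h.2.2.2.1 k)]
  exact Nat.mul_pos (Nat.pos_of_ne_zero (h.2.2.2.1 k)) (h.w_pos k)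

/-- `μ k ≥ N k k > 0`. [cite: Rogawski1990, §3.6 pp. 28–31] -/
theorem IsFinerCount.μ_pos (h : IsFinerCount μ N w wF) (k : ι) : 0 < μ k := by
  rw [← h.2.2.2.2.2 k]
  exact lt_of_lt_of_le (Nat.pos_of_ne_zero (h.2.2.2.1 k)) (Finset.single_le_sum (fun _ _ => Nat.zero_le _) (Finset.mem_univ k))

/-- The reachable sets from the two sides agree: `{i | N i k ≠ 0} = {i | N k i ≠ 0}` ((F3)). [cite: Rogawski1990, §3.6 pp. 28–31] -/
theorem IsFinerCount.filter_ne_zero_comm (h : IsFinerCount μ N w wF) (k : ι) :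
    Finset.univ.filter (fun i => N i k ≠ 0) = Finset.univ.filter (fun i => N k i ≠ 0) :=
  Finset.filter_congr fun i _ => ⟨h.2.2.1 i k, h.2.2.1 k i⟩

/-! ## §2 The consequences: class equation, S-count (C), T-count -/

/-- **CLASS EQUATION** (S4-R27 (1): «`Σ_{T″ ∼_{st} T} |Ω(T″)|⁻¹ = |𝔇(T∕F)|∕|Ω_F(T)|`»): `Σ_{i : N k i ≠ 0} [N(T_i):T_i]⁻¹ = μ k ∕ wF k` — from (F6) `Σ_i N k i = μ k` with `N k i = wF k ∕ w i`
on the reachable `i` ((F1), (F2)). [cite: Rogawski1990, §12.5 p. 182] -/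
theorem IsFinerCount.sum_filter_inv_index_eq (h : IsFinerCount μ N w wF) (k : ι) :
    ∑ i ∈ Finset.univ.filter (fun i => N k i ≠ 0), ((w i : ℝ))⁻¹ = (μ k : ℝ) / (wF k : ℝ) := by
  have hwF : (wF k : ℝ) ≠ 0 := Nat.cast_ne_zero.mpr (h.wF_pos k).ne'
  rw [eq_div_iff hwF, Finset.sum_mul]
  have hμ : (μ k : ℝ) = ∑ i, (N k i : ℝ) := by
    rw [← h.2.2.2.2.2 k, Nat.cast_sum]
  rw [hμ, ← Finset.sum_filter_of_ne (s := Finset.univ) (p := fun i => N k i ≠ 0) (f := fun i => (N k i : ℝ))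
    (fun i _ hi => by exact_mod_cast hi)]
  refine Finset.sum_congr rfl fun i hi => ?_
  have hki : N k i ≠ 0 := (Finset.mem_filter.mp hi).2
  have hw : (w i : ℝ) ≠ 0 := Nat.cast_ne_zero.mpr (h.w_pos i).ne'
  rw [(h.2.1 k i hki).2, ← h.1 k i hki, Nat.cast_mul]
  field_simp

/-- **THE S-COUNT = clause (C) of ★ `IsStableTransportDict`** (the `hC` of ★ `isStableTransportDict_of_forall_member`, verbatim in `(μ, N, w)`):
`Σ_i N i k · ([N(T_i):T_i] · μ i)⁻¹ = [N(T_k):T_k]⁻¹` — on the reachable `i`, `N i k = wF k ∕ w k` and `μ i = μ k`, then the class equation. [cite: Rogawski1990, §12.5 p. 182] -/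
theorem IsFinerCount.sCount (h : IsFinerCount μ N w wF) (k : ι) :
    ∑ i, (N i k : ℝ) * (((w i : ℝ))⁻¹ * ((μ i : ℝ))⁻¹) = ((w k : ℝ))⁻¹ := by
  have hwF : (wF k : ℝ) ≠ 0 := Nat.cast_ne_zero.mpr (h.wF_pos k).ne'
  have hwk : (w k : ℝ) ≠ 0 := Nat.cast_ne_zero.mpr (h.w_pos k).ne'
  have hμk : (μ k : ℝ) ≠ 0 := Nat.cast_ne_zero.mpr (h.μ_pos k).ne'
  rw [← Finset.sum_filter_of_ne (s := Finset.univ) (p := fun i => N i k ≠ 0) (fun i _ hi => by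
    intro h0
    apply hi
    rw [h0, Nat.cast_zero, zero_mul])]
  have key : ∀ i ∈ Finset.univ.filter (fun i => N i k ≠ 0),
      (N i k : ℝ) * (((w i : ℝ))⁻¹ * ((μ i : ℝ))⁻¹) = ((wF k : ℝ) / ((w k : ℝ) * (μ k : ℝ))) * ((w i : ℝ))⁻¹ := by
    intro i hi
    have hik : N i k ≠ 0 := (Finset.mem_filter.mp hi).2
    have hN : (N i k : ℝ) = (wF k : ℝ) / (w k : ℝ) := by
      rw [eq_div_iff hwk, ← Nat.cast_mul, h.1 i k hik]
    rw [hN, (h.2.1 i k hik).1]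
    field_simp
  rw [Finset.sum_congr rfl key, ← Finset.mul_sum, h.filter_ne_zero_comm k, h.sum_filter_inv_index_eq k]
  field_simp

/-- **THE T-COUNT = (WEYL-COUNT-T) of the twisted Weyl formula**: `wF k · Σ_{i : N k i ≠ 0} ([N(T_i):T_i] · μ i)⁻¹ = 1` — `μ i = μ k` on the reachable `i`, then the class
equation.  (The T-WIF assembly reads «`N k i ≠ 0`» as «the ε-tubes over `T_k, T_i` coincide», ★ `R90S4EpsTubeEq`, and `wF k` as the ε-Weyl count `|W̃^ε_{T_k}|`.)
[cite: Rogawski1990, §12.5 pp. 182, 186] -/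
theorem IsFinerCount.tCount (h : IsFinerCount μ N w wF) (k : ι) :
    (wF k : ℝ) * ∑ i ∈ Finset.univ.filter (fun i => N k i ≠ 0), ((w i : ℝ) * (μ i : ℝ))⁻¹ = 1 := by
  have hwF : (wF k : ℝ) ≠ 0 := Nat.cast_ne_zero.mpr (h.wF_pos k).ne'
  have hμk : (μ k : ℝ) ≠ 0 := Nat.cast_ne_zero.mpr (h.μ_pos k).ne'
  have key : ∀ i ∈ Finset.univ.filter (fun i => N k i ≠ 0), ((w i : ℝ) * (μ i : ℝ))⁻¹ = ((μ k : ℝ))⁻¹ * ((w i : ℝ))⁻¹ := by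
    intro i hi
    rw [← (h.2.1 k i (Finset.mem_filter.mp hi).2).1, mul_inv, mul_comm]
  rw [Finset.sum_congr rfl key, ← Finset.mul_sum, h.sum_filter_inv_index_eq k]
  field_simp

/-- **The T-count, indicator-free twin**: `Σ_i N k i · (wF i · μ i)⁻¹ = (wF k)⁻¹`. [cite: Rogawski1990, §12.5 pp. 182, 186] -/
theorem IsFinerCount.tCount' (h : IsFinerCount μ N w wF) (k : ι) :
    ∑ i, (N k i : ℝ) * (((wF i : ℝ) * (μ i : ℝ))⁻¹) = ((wF k : ℝ))⁻¹ := by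
  have hwF : (wF k : ℝ) ≠ 0 := Nat.cast_ne_zero.mpr (h.wF_pos k).ne'
  have hμk : (μ k : ℝ) ≠ 0 := Nat.cast_ne_zero.mpr (h.μ_pos k).ne'
  rw [← Finset.sum_filter_of_ne (s := Finset.univ) (p := fun i => N k i ≠ 0) (fun i _ hi => by
    intro h0
    apply hi
    rw [h0, Nat.cast_zero, zero_mul])]
  have key : ∀ i ∈ Finset.univ.filter (fun i => N k i ≠ 0),
      (N k i : ℝ) * (((wF i : ℝ) * (μ i : ℝ))⁻¹) = ((μ k : ℝ))⁻¹ * ((w i : ℝ))⁻¹ := by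
    intro i hi
    have hki : N k i ≠ 0 := (Finset.mem_filter.mp hi).2
    have hw : (w i : ℝ) ≠ 0 := Nat.cast_ne_zero.mpr (h.w_pos i).ne'
    have hwFi : (wF i : ℝ) ≠ 0 := by rw [← (h.2.1 k i hki).2]; exact hwF
    have hN : (N k i : ℝ) = (wF i : ℝ) / (w i : ℝ) := by
      rw [eq_div_iff hw, ← Nat.cast_mul, h.1 k i hki]
    rw [hN, ← (h.2.1 k i hki).1]
    field_simp
  rw [Finset.sum_congr rfl key, ← Finset.mul_sum, h.sum_filter_inv_index_eq k]
  field_simp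

end WeylCountFiner

end Summit.HodgeConjecture.HodgeConjecture.R90.S4
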